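import Summits.CriticalPhenomena.Ising3DConformalLimit.Theorems.HyperoctahedralRPExistsScaleCovariantLimitDecimationTwoCouplingGKS
import Summits.CriticalPhenomena.Ising3DConformalLimit.Theorems.HyperoctahedralRPExistsScaleCovariantLimitDecimationBoxBridge
import Literature.Probability.LatticeModels.PlanarIsingCriticalBeta
import Literature.Probability.LatticeModels.OnsagerYang
import Literature.Probability.LatticeModels.CriticalTwoPointLower
import HarnessLib

/-!
# Decoration (decimation) identity for the pair-coupling Gibbs average, and the planar inputs of stub (S)

Crux `TwinThreshold` (stmt-CriticalPhenomena-16906), line `seam_renewal`, stub `stub_strongSeamOrder` ((S) plane order at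
strong seam coupling). This is the model-independent half of the proof, landed first and imported by the stub file
`ReflectionTwinTwinThresholdStrongSeamOrder.lean`:

* §1 `gibbsAvg_symmHalf` — the Gibbs average only sees the symmetrised coupling matrix `(c_{ab} + c_{ba})/2`.
* §2 `gibbsAvg_decCoupling` — **the decoration–iteration identity** (Fisher's decoration transformation run backwards,
  cf. `PairIsing.sum_units_exp_decoration` in tree): if every decoration spin `z` (`D z`) is joined to exactly two
  non-decoration sites `u z ≠ v z` by bonds of coupling `K` and to nothing else (`decCoupling`), then summing the
  decoration spins out of numerator and denominator leaves the pair model on `{a // ¬ D a}` in which each decoration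
  contributes the bond `{u z, v z}` with coupling `decorK K = ½ log cosh 2K` (`decEff`).
* §3 `gibbsAvg_nn2_pair` — the pair-coupling box average with nearest-neighbour couplings `β/2` per ordered pair on
  `box 2 N` IS the free finite-volume two-point function `isingTwoPoint (zdGraph 2) (box 2 N) β 0 .free`
  (the `d = 2` copy of the tree's `stub_boxBridge`).
* §4 `criticalBetaTwo_lt_decorK_two`, `stub_strongSeamOrder_partD_planarOrder` (registered sub-goal) — `½ log cosh 4 > ½ log (1 + √2) = β_c(2)`,
  hence the free planar two-point function at `β₂ = decorK 2` is bounded below by `m*(β₂)² > 0` uniformly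
  (`criticalBeta_two_holds`, `spontaneousMagnetization_pos_of_criticalBeta_lt_holds`,
  `twoPointFree_eq_twoPointPlus_of_criticalBetaTwo_lt_holds`, `spontaneousMagnetization_sq_le_twoPointPlus`), and
  `twoPointFree_le_ciSup_of_box_le` — a box-limit comparison lemma.

References: M. E. Fisher, Phys. Rev. 113 (1959) 969 (decoration transformation); D. A. Lavis, G. M. Bell,
*Statistical Mechanics of Lattice Systems 1* (Springer 1999) §8 (decoration); S. Friedli, Y. Velenik, *Statistical
Mechanics of Lattice Systems* (CUP 2017) §3.1, §3.7, §3.10.1. Elementary finite sums; no `sorry`, no new axioms.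
-/

noncomputable section

namespace Summit.CriticalPhenomena.Ising3DConformalLimit.Cruxes.TwinThreshold.SeamRenewal

open scoped BigOperators Classical
open Filter Topology Finset
open Literature.Probability.LatticeModels
open Summit.CriticalPhenomena.Ising3DConformalLimit.Cruxes.ExistsScaleCovariantLimit.DecimationHomotopyRate

namespace StrongSeamOrder

/-! ## §1 The Gibbs average only sees the symmetrised couplings -/

section Symm

variable {ι : Type*} [Fintype ι] [DecidableEq ι]

omit [DecidableEq ι] in
/-- The Boltzmann weight depends on the couplings only through their symmetrisation. [folklore] -/
theorem gibbsWeight_symmHalf (c : ι → ι → ℝ) (σ : SpinConfig ι) :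
    PairIsing.gibbsWeight (fun a b => (c a b + c b a) / 2) σ = PairIsing.gibbsWeight c σ := by
  unfold PairIsing.gibbsWeight
  congr 1
  have hT : ∑ a, ∑ b, c b a * (spinAt a σ * spinAt b σ) = ∑ a, ∑ b, c a b * (spinAt a σ * spinAt b σ) := by
    rw [Finset.sum_comm]
    exact Finset.sum_congr rfl fun a _ => Finset.sum_congr rfl fun b _ => by ring
  have hS : ∑ a, ∑ b, (c a b + c b a) / 2 * (spinAt a σ * spinAt b σ) =
      (∑ a, ∑ b, c a b * (spinAt a σ * spinAt b σ) + ∑ a, ∑ b, c b a * (spinAt a σ * spinAt b σ)) / 2 := by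
    rw [← Finset.sum_add_distrib, Finset.sum_div]
    refine Finset.sum_congr rfl fun a _ => ?_
    rw [← Finset.sum_add_distrib, Finset.sum_div]
    exact Finset.sum_congr rfl fun b _ => by ring
  rw [hS, hT]
  ring

/-- **Symmetrisation invariance**: `⟨f⟩_{(c + cᵀ)/2} = ⟨f⟩_c`. [folklore] -/
theorem gibbsAvg_symmHalf (c : ι → ι → ℝ) (f : SpinConfig ι → ℝ) :
    PairIsing.gibbsAvg (fun a b => (c a b + c b a) / 2) f = PairIsing.gibbsAvg c f := by
  simp only [PairIsing.gibbsAvg_def, gibbsWeight_symmHalf]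

end Symm

/-! ## §2 The decoration–iteration identity -/

section Decimation

variable {ι : Type*} [Fintype ι] [DecidableEq ι] {D : ι → Prop} [DecidablePred D] {u v : ι → ι} (K : ℝ)

/-! Throughout this section the DECORATED coupling matrix is the explicit lambda
`fun a b : ι => (if D a ∧ (b = u a ∨ b = v a) then K / 2 else 0) + (if D b ∧ (a = u b ∨ a = v b) then K / 2 else 0)`
(every decoration spin `z`, `D z`, is joined to its two ends `u z`, `v z` by a bond of coupling `K`, entry `K/2` in both
orientations, and there are no other bonds), and the EFFECTIVE coupling matrix on the non-decoration sites is
`fun q q' : {a // ¬ D a} => decorK K * ∑ z : {z // D z}, if u z.1 = q.1 ∧ v z.1 = q'.1 then 1 else 0` (the decoration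
`z` contributes `decorK K` to the entry `(u z, v z)`). No definition is introduced. -/

/-- One row of the decorated exponent. [folklore] -/
theorem sum_decRow (huv : ∀ z, D z → u z ≠ v z) (σ : SpinConfig ι) (a : ι) :
    ∑ b, (if D a ∧ (b = u a ∨ b = v a) then K / 2 else 0) * (spinAt a σ * spinAt b σ) =
      if D a then K / 2 * (spinAt a σ * spinAt (u a) σ + spinAt a σ * spinAt (v a) σ) else 0 := by
  by_cases ha : D a
  · rw [if_pos ha]
    have hsplit : ∀ b, (if D a ∧ (b = u a ∨ b = v a) then K / 2 else 0) * (spinAt a σ * spinAt b σ) =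
        (if b = u a then K / 2 * (spinAt a σ * spinAt b σ) else 0) +
          (if b = v a then K / 2 * (spinAt a σ * spinAt b σ) else 0) := by
      intro b
      by_cases h1 : b = u a
      · have h2 : b ≠ v a := h1 ▸ huv a ha
        rw [if_pos ⟨ha, Or.inl h1⟩, if_pos h1, if_neg h2, add_zero]
      · by_cases h2 : b = v a
        · rw [if_pos ⟨ha, Or.inr h2⟩, if_neg h1, if_pos h2, zero_add]
        · rw [if_neg (fun h => h.2.elim h1 h2), if_neg h1, if_neg h2, zero_mul, add_zero]
    rw [Finset.sum_congr rfl fun b _ => hsplit b, Finset.sum_add_distrib, Finset.sum_ite_eq' univ (u a),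
      Finset.sum_ite_eq' univ (v a), if_pos (mem_univ _), if_pos (mem_univ _)]
    ring
  · rw [if_neg ha]
    exact Finset.sum_eq_zero fun b _ => by rw [if_neg (fun h => ha h.1), zero_mul]

/-- **The decorated exponent**: `∑_{a,b} c_{ab} σ_aσ_b = ∑_{z : D} K σ_z (σ_{u z} + σ_{v z})`. [folklore] -/
theorem sum_sum_decCoupling (huv : ∀ z, D z → u z ≠ v z) (σ : SpinConfig ι) :
    ∑ a, ∑ b, (fun a b : ι =>
        (if D a ∧ (b = u a ∨ b = v a) then K / 2 else 0) + (if D b ∧ (a = u b ∨ a = v b) then K / 2 else 0)) a b * (spinAt a σ * spinAt b σ) =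
      ∑ z : {z // D z}, K * (spinAt z.1 σ * spinAt (u z.1) σ + spinAt z.1 σ * spinAt (v z.1) σ) := by
  have hhalf : ∑ a, ∑ b, (if D a ∧ (b = u a ∨ b = v a) then K / 2 else 0) * (spinAt a σ * spinAt b σ) =
      ∑ z : {z // D z}, K / 2 * (spinAt z.1 σ * spinAt (u z.1) σ + spinAt z.1 σ * spinAt (v z.1) σ) := by
    rw [Finset.sum_congr rfl fun a _ => sum_decRow K huv σ a, ← Finset.sum_filter]
    exact Finset.sum_subtype _ (fun a => by rw [Finset.mem_filter, and_iff_right (mem_univ a)]) _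
  have hswap : ∑ a, ∑ b, (if D b ∧ (a = u b ∨ a = v b) then K / 2 else 0) * (spinAt a σ * spinAt b σ) =
      ∑ a, ∑ b, (if D a ∧ (b = u a ∨ b = v a) then K / 2 else 0) * (spinAt a σ * spinAt b σ) := by
    rw [Finset.sum_comm]
    exact Finset.sum_congr rfl fun a _ => Finset.sum_congr rfl fun b _ => by ring
  calc ∑ a, ∑ b, (fun a b : ι =>
        (if D a ∧ (b = u a ∨ b = v a) then K / 2 else 0) + (if D b ∧ (a = u b ∨ a = v b) then K / 2 else 0)) a b * (spinAt a σ * spinAt b σ)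
      = ∑ a, ∑ b, (if D a ∧ (b = u a ∨ b = v a) then K / 2 else 0) * (spinAt a σ * spinAt b σ) +
          ∑ a, ∑ b, (if D b ∧ (a = u b ∨ a = v b) then K / 2 else 0) * (spinAt a σ * spinAt b σ) := by
        rw [← Finset.sum_add_distrib]
        refine Finset.sum_congr rfl fun a _ => ?_
        rw [← Finset.sum_add_distrib]
        exact Finset.sum_congr rfl fun b _ => by ring
    _ = _ := by
        rw [hswap, hhalf, ← Finset.sum_add_distrib]
        exact Finset.sum_congr rfl fun z _ => by ring

/-- The decorated Boltzmann weight is a product over the decorations. [folklore] -/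
theorem gibbsWeight_decCoupling (huv : ∀ z, D z → u z ≠ v z) (σ : SpinConfig ι) :
    PairIsing.gibbsWeight (fun a b : ι =>
        (if D a ∧ (b = u a ∨ b = v a) then K / 2 else 0) + (if D b ∧ (a = u b ∨ a = v b) then K / 2 else 0)) σ =
      ∏ z : {z // D z}, Real.exp (K * (spinAt z.1 σ * spinAt (u z.1) σ + spinAt z.1 σ * spinAt (v z.1) σ)) := by
  rw [PairIsing.gibbsWeight, sum_sum_decCoupling K huv σ, Real.exp_sum]

/-- The effective Boltzmann weight: `w_{eff}(ρ) = exp(∑_{z : D} K' ρ_{u z} ρ_{v z})`, `K' = decorK K`. [folklore] -/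
theorem gibbsWeight_decEff (hu : ∀ z, D z → ¬ D (u z)) (hv : ∀ z, D z → ¬ D (v z))
    (ρ : SpinConfig {a // ¬ D a}) :
    PairIsing.gibbsWeight (fun q q' : {a // ¬ D a} =>
        PairIsing.decorK K * ∑ z : {z // D z}, if u z.1 = q.1 ∧ v z.1 = q'.1 then (1 : ℝ) else 0) ρ =
      Real.exp (∑ z : {z // D z}, PairIsing.decorK K *
        (spinAt (⟨u z.1, hu z.1 z.2⟩ : {a // ¬ D a}) ρ * spinAt (⟨v z.1, hv z.1 z.2⟩ : {a // ¬ D a}) ρ)) := by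
  unfold PairIsing.gibbsWeight
  congr 1
  have key : ∀ z : {z // D z},
      ∑ q : {a // ¬ D a}, ∑ q' : {a // ¬ D a},
        (if u z.1 = q.1 ∧ v z.1 = q'.1 then PairIsing.decorK K * (spinAt q ρ * spinAt q' ρ) else 0) =
      PairIsing.decorK K *
        (spinAt (⟨u z.1, hu z.1 z.2⟩ : {a // ¬ D a}) ρ * spinAt (⟨v z.1, hv z.1 z.2⟩ : {a // ¬ D a}) ρ) := by
    intro z
    rw [Finset.sum_eq_single (⟨u z.1, hu z.1 z.2⟩ : {a // ¬ D a}),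
      Finset.sum_eq_single (⟨v z.1, hv z.1 z.2⟩ : {a // ¬ D a}), if_pos ⟨rfl, rfl⟩]
    · intro q' _ hq'
      exact if_neg fun h => hq' (Subtype.ext h.2.symm)
    · exact fun h => (h (mem_univ _)).elim
    · intro q _ hq
      exact Finset.sum_eq_zero fun q' _ => if_neg fun h => hq (Subtype.ext h.1.symm)
    · exact fun h => (h (mem_univ _)).elim
  calc ∑ q : {a // ¬ D a}, ∑ q' : {a // ¬ D a},
        (PairIsing.decorK K * ∑ z : {z // D z}, if u z.1 = q.1 ∧ v z.1 = q'.1 then (1 : ℝ) else 0) *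
          (spinAt q ρ * spinAt q' ρ)
      = ∑ q : {a // ¬ D a}, ∑ q' : {a // ¬ D a}, ∑ z : {z // D z},
          (if u z.1 = q.1 ∧ v z.1 = q'.1 then PairIsing.decorK K * (spinAt q ρ * spinAt q' ρ) else 0) := by
        refine Finset.sum_congr rfl fun q _ => Finset.sum_congr rfl fun q' _ => ?_
        rw [Finset.mul_sum, Finset.sum_mul]
        refine Finset.sum_congr rfl fun z _ => ?_
        split_ifs <;> ring
    _ = ∑ z : {z // D z}, ∑ q : {a // ¬ D a}, ∑ q' : {a // ¬ D a},
          (if u z.1 = q.1 ∧ v z.1 = q'.1 then PairIsing.decorK K * (spinAt q ρ * spinAt q' ρ) else 0) := by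
        rw [Finset.sum_congr rfl fun q _ => Finset.sum_comm, Finset.sum_comm]
    _ = _ := Finset.sum_congr rfl fun z _ => key z

/-- **Summing out the decorations** (numerator form): for an observable `g` of the non-decoration spins,
`∑_σ g(σ|_{¬D}) w_dec(σ) = (2 e^{K'})^{|D|} ∑_ρ g(ρ) w_eff(ρ)`. [folklore] -/
theorem sum_mul_gibbsWeight_decCoupling (hu : ∀ z, D z → ¬ D (u z)) (hv : ∀ z, D z → ¬ D (v z))
    (huv : ∀ z, D z → u z ≠ v z) (g : SpinConfig {a // ¬ D a} → ℝ) :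
    ∑ σ : SpinConfig ι, g (fun a => σ a.1) * PairIsing.gibbsWeight (fun a b : ι =>
        (if D a ∧ (b = u a ∨ b = v a) then K / 2 else 0) + (if D b ∧ (a = u b ∨ a = v b) then K / 2 else 0)) σ =
      (2 * Real.exp (PairIsing.decorK K)) ^ Fintype.card {z // D z} *
        ∑ ρ : SpinConfig {a // ¬ D a}, g ρ * PairIsing.gibbsWeight (fun q q' : {a // ¬ D a} =>
        PairIsing.decorK K * ∑ z : {z // D z}, if u z.1 = q.1 ∧ v z.1 = q'.1 then (1 : ℝ) else 0) ρ := by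
  set e := Equiv.piEquivPiSubtypeProd D (fun _ : ι => ℤˣ) with he
  -- the factor of one decoration `z` with spin `w`, as a function of the non-decoration spins `ρ`
  set φ : SpinConfig {a // ¬ D a} → {z // D z} → ℤˣ → ℝ := fun ρ z w =>
    Real.exp (K * (((w : ℤ) : ℝ) * spinAt (⟨u z.1, hu z.1 z.2⟩ : {a // ¬ D a}) ρ +
      ((w : ℤ) : ℝ) * spinAt (⟨v z.1, hv z.1 z.2⟩ : {a // ¬ D a}) ρ)) with hφ
  have hF : ∀ (η : {z // D z} → ℤˣ) (ρ : SpinConfig {a // ¬ D a}),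
      g (fun a => (e.symm (η, ρ)) a.1) * PairIsing.gibbsWeight (fun a b : ι =>
        (if D a ∧ (b = u a ∨ b = v a) then K / 2 else 0) + (if D b ∧ (a = u b ∨ a = v b) then K / 2 else 0)) (e.symm (η, ρ)) =
        g ρ * ∏ z, φ ρ z (η z) := by
    intro η ρ
    have h1 : (fun a : {a // ¬ D a} => (e.symm (η, ρ)) a.1) = ρ := by
      funext a
      simp [he, a.2]
    rw [h1, gibbsWeight_decCoupling K huv]
    congr 1
    refine Finset.prod_congr rfl fun z _ => ?_
    simp only [hφ, spinAt, he, Equiv.piEquivPiSubtypeProd_symm_apply, dif_pos z.2, dif_neg (hu z.1 z.2),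
      dif_neg (hv z.1 z.2)]
  calc ∑ σ : SpinConfig ι, g (fun a => σ a.1) * PairIsing.gibbsWeight (fun a b : ι =>
        (if D a ∧ (b = u a ∨ b = v a) then K / 2 else 0) + (if D b ∧ (a = u b ∨ a = v b) then K / 2 else 0)) σ
      = ∑ q : ({z // D z} → ℤˣ) × ({a // ¬ D a} → ℤˣ),
          g (fun a => (e.symm q) a.1) * PairIsing.gibbsWeight (fun a b : ι =>
        (if D a ∧ (b = u a ∨ b = v a) then K / 2 else 0) + (if D b ∧ (a = u b ∨ a = v b) then K / 2 else 0)) (e.symm q) :=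
        (Fintype.sum_equiv e.symm _ _ fun q => rfl).symm
    _ = ∑ η : {z // D z} → ℤˣ, ∑ ρ : SpinConfig {a // ¬ D a}, g ρ * ∏ z, φ ρ z (η z) := by
        rw [Fintype.sum_prod_type]
        exact Finset.sum_congr rfl fun η _ => Finset.sum_congr rfl fun ρ _ => hF η ρ
    _ = ∑ ρ : SpinConfig {a // ¬ D a}, g ρ * ∑ η : {z // D z} → ℤˣ, ∏ z, φ ρ z (η z) := by
        rw [Finset.sum_comm]
        exact Finset.sum_congr rfl fun ρ _ => by rw [Finset.mul_sum]
    _ = ∑ ρ : SpinConfig {a // ¬ D a}, g ρ * ∏ z : {z // D z}, ∑ w : ℤˣ, φ ρ z w := by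
        refine Finset.sum_congr rfl fun ρ _ => ?_
        rw [Fintype.prod_sum]
    _ = ∑ ρ : SpinConfig {a // ¬ D a}, g ρ * ∏ z : {z // D z}, (2 * Real.exp (PairIsing.decorK K) *
          Real.exp (PairIsing.decorK K * (spinAt (⟨u z.1, hu z.1 z.2⟩ : {a // ¬ D a}) ρ *
            spinAt (⟨v z.1, hv z.1 z.2⟩ : {a // ¬ D a}) ρ))) := by
        refine Finset.sum_congr rfl fun ρ _ => ?_
        congr 1
        exact Finset.prod_congr rfl fun z _ =>
          PairIsing.sum_units_exp_decoration K (spinAt_eq_one_or_eq_neg_one _ _) (spinAt_eq_one_or_eq_neg_one _ _)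
    _ = _ := by
        rw [Finset.mul_sum]
        refine Finset.sum_congr rfl fun ρ _ => ?_
        rw [Finset.prod_mul_distrib, Finset.prod_const, Finset.card_univ, ← Real.exp_sum,
          gibbsWeight_decEff K hu hv]
        ring

/-- **The decoration–iteration identity for the Gibbs average**: if every decoration spin is joined to exactly two
non-decoration sites `u z ≠ v z` by bonds of coupling `K` and to nothing else, then for every observable `g` of the
non-decoration spins `⟨g(σ|_{¬D})⟩_{dec} = ⟨g⟩_{eff}`, the effective model carrying the bond `{u z, v z}` with coupling
`decorK K = ½ log cosh 2K` for each decoration `z` (the constants `(2e^{K'})^{|D|}` cancel). [folklore] -/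
theorem gibbsAvg_decCoupling (hu : ∀ z, D z → ¬ D (u z)) (hv : ∀ z, D z → ¬ D (v z))
    (huv : ∀ z, D z → u z ≠ v z) (g : SpinConfig {a // ¬ D a} → ℝ) :
    PairIsing.gibbsAvg (fun a b : ι =>
        (if D a ∧ (b = u a ∨ b = v a) then K / 2 else 0) + (if D b ∧ (a = u b ∨ a = v b) then K / 2 else 0)) (fun σ => g (fun a => σ a.1)) =
      PairIsing.gibbsAvg (fun q q' : {a // ¬ D a} =>
        PairIsing.decorK K * ∑ z : {z // D z}, if u z.1 = q.1 ∧ v z.1 = q'.1 then (1 : ℝ) else 0) g := by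
  have hC : (2 * Real.exp (PairIsing.decorK K)) ^ Fintype.card {z // D z} ≠ 0 := pow_ne_zero _ (by positivity)
  rw [PairIsing.gibbsAvg_def, PairIsing.gibbsAvg_def, sum_mul_gibbsWeight_decCoupling K hu hv huv g]
  have h1 := sum_mul_gibbsWeight_decCoupling K hu hv huv (fun _ => (1 : ℝ))
  simp only [one_mul] at h1
  rw [h1, mul_div_mul_left _ _ hC]

end Decimation

/-! ## §3 The planar box bridge: pair-coupling average with n.n. couplings = free Ising two-point function -/

section Planar

/-! The homogeneous nearest-neighbour coupling `β` on the planar box `box 2 N` (free boundary condition) is written as the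
explicit matrix `fun a b : ↥(box 2 N) => if (zdGraph 2).Adj a.1 b.1 then β / 2 else 0` (`β/2` on each ORDERED pair of
adjacent sites of `ℤ²`, so that the unordered bond carries `β`); no definition is introduced. -/

-- adapted from `gibbsWeight_nnCoupling_eq_isingWeight` (Theorems/HyperoctahedralRPExistsScaleCovariantLimitDecimationBoxBridge.lean), `d = 2`
/-- **The pair-coupling Boltzmann weight of the planar n.n. matrix is the free zero-field Ising weight on the planar box**:
`exp(∑_a ∑_b c_{ab} τ_a τ_b) = exp(β ∑_{e ∈ ℰ_{Λ_N}} τ_e)` (each edge is two ordered pairs).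
[cite: FriedliVelenik2017, §3.1, eqs. (3.2), (3.7)] -/
theorem gibbsWeight_nn2_eq_isingWeight (N : ℕ) (β : ℝ) (τ : SpinConfig ↥(box 2 N)) :
    PairIsing.gibbsWeight (fun a b : ↥(box 2 N) => if (zdGraph 2).Adj a.1 b.1 then β / 2 else 0) τ =
      isingWeight (zdGraph 2) (box 2 N) β 0 .free τ := by
  rw [PairIsing.gibbsWeight, isingWeight]
  congr 1
  simp only [isingHamiltonian, interactionEdges_free, zero_mul, sub_zero, mul_neg, neg_mul, neg_neg]
  set σ : SpinConfig (Site 2) := glue (box 2 N) τ .free with hσ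
  have hs : ∀ a : ↥(box 2 N), spinAt a τ = spinAt (a : Site 2) σ := by
    intro a
    rw [hσ, spinAt_glue_coe]
  simp_rw [hs]
  set g : Site 2 → Site 2 → ℝ :=
    fun x y => (if (zdGraph 2).Adj x y then β / 2 else 0) * (spinAt x σ * spinAt y σ) with hg
  calc ∑ a : ↥(box 2 N), ∑ b : ↥(box 2 N), g a b = ∑ a : ↥(box 2 N), ∑ y ∈ box 2 N, g a y :=
        Finset.sum_congr rfl fun a _ => Finset.sum_coe_sort (box 2 N) (g a)
    _ = ∑ x ∈ box 2 N, ∑ y ∈ box 2 N, g x y := Finset.sum_coe_sort (box 2 N) (fun x => ∑ y ∈ box 2 N, g x y)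
    _ = ∑ x ∈ box 2 N, ∑ y ∈ (box 2 N).filter ((zdGraph 2).Adj x), β / 2 * (spinAt x σ * spinAt y σ) := by
        refine Finset.sum_congr rfl fun x _ => ?_
        rw [Finset.sum_filter]
        refine Finset.sum_congr rfl fun y _ => ?_
        simp only [hg]
        split_ifs <;> simp
    _ = ∑ e ∈ edgesIn (zdGraph 2) (box 2 N), β * bondSpin σ e := by
        rw [sum_adj_eq_sum_edgesIn_lift (zdGraph 2) (box 2 N)]
        refine Finset.sum_congr rfl fun e _ => ?_
        induction e using Sym2.ind with
        | _ x y => rw [Sym2.lift_mk, bondSpin_mk]; ring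
    _ = β * ∑ e ∈ edgesIn (zdGraph 2) (box 2 N), bondSpin σ e := (Finset.mul_sum _ _ _).symm

/-- **Planar box bridge for pairs**: for `x, y ∈ box 2 N`,
`⟨τ_x τ_y⟩_{n.n., β} = ⟨σ_x σ_y⟩^{free}_{box 2 N; β, 0}` (same Boltzmann weight, `integral_isingMeasure`).
[cite: FriedliVelenik2017, §3.1, eq. (3.8)] -/
theorem gibbsAvg_nn2_pair (N : ℕ) (β : ℝ) {x y : Site 2} (hx : x ∈ box 2 N) (hy : y ∈ box 2 N) :
    PairIsing.gibbsAvg (fun a b : ↥(box 2 N) => if (zdGraph 2).Adj a.1 b.1 then β / 2 else 0)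
        (fun τ => spinAt (⟨x, hx⟩ : ↥(box 2 N)) τ * spinAt (⟨y, hy⟩ : ↥(box 2 N)) τ) =
      isingTwoPoint (zdGraph 2) (box 2 N) β 0 .free x y := by
  have hnum : ∑ ρ : SpinConfig ↥(box 2 N),
      spinAt (⟨x, hx⟩ : ↥(box 2 N)) ρ * spinAt (⟨y, hy⟩ : ↥(box 2 N)) ρ *
        PairIsing.gibbsWeight (fun a b : ↥(box 2 N) => if (zdGraph 2).Adj a.1 b.1 then β / 2 else 0) ρ =
      ∑ τ : SpinConfig ↥(box 2 N), isingWeight (zdGraph 2) (box 2 N) β 0 .free τ *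
        spinPair x y (glue (box 2 N) τ .free) :=
    Finset.sum_congr rfl fun τ _ => by
      rw [gibbsWeight_nn2_eq_isingWeight, spinPair, spinAt_glue_of_mem τ .free hx,
        spinAt_glue_of_mem τ .free hy, mul_comm]
  have hden : ∑ ρ, PairIsing.gibbsWeight (fun a b : ↥(box 2 N) => if (zdGraph 2).Adj a.1 b.1 then β / 2 else 0) ρ =
      isingPartitionFunction (zdGraph 2) (box 2 N) β 0 .free :=
    Finset.sum_congr rfl fun τ _ => gibbsWeight_nn2_eq_isingWeight N β τ
  rw [PairIsing.gibbsAvg_def, hnum, hden, isingTwoPoint, isingExpect,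
    integral_isingMeasure (zdGraph 2) (box 2 N) β 0 .free (measurable_spinPair x y)]

/-! ## §4 The planar inputs: `β₂ = ½ log cosh 4 > β_c(2)` and the uniform lower bound `m*(β₂)²` -/

/-- **Numerics**: `β_c(2) = ½ log (1 + √2) < ½ log cosh 4 = decorK 2` (`cosh 4 ≥ (1 + 4)/2 > 1 + √2`). [folklore] -/
theorem criticalBetaTwo_lt_decorK_two : criticalBetaTwo < PairIsing.decorK 2 := by
  rw [criticalBetaTwo, PairIsing.decorK]
  have hsqrt : Real.sqrt 2 < 3 / 2 := (Real.sqrt_lt' (by norm_num)).2 (by norm_num)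
  have hexp : (4 : ℝ) + 1 ≤ Real.exp 4 := Real.add_one_le_exp 4
  have hexp' : 0 < Real.exp (-4) := Real.exp_pos _
  have hcosh : 1 + Real.sqrt 2 < Real.cosh (2 * 2) := by
    rw [show (2 : ℝ) * 2 = 4 by norm_num, Real.cosh_eq]
    linarith
  have hlog := Real.log_lt_log (by positivity) hcosh
  set A := Real.log (1 + Real.sqrt 2)
  set B := Real.log (Real.cosh (2 * 2))
  linarith

/-- **Box-limit comparison**: if along the planar boxes the free two-point function `⟨σ₀σ_p⟩^{free}_{box 2 N; β}`
(`β ≥ 0`) is eventually bounded by the terms `T (g N)` of a bounded sequence, then `⟨σ₀σ_p⟩^{free}_β ≤ sup_L T L`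
(existence of the free state along boxes, `tendsto_isingTwoPoint_free`). [cite: FriedliVelenik2017, Exercise 3.16] -/
theorem twoPointFree_le_ciSup_of_box_le {β : ℝ} (hβ : 0 ≤ β) (p : Site 2) {T : ℕ → ℝ}
    (hT : BddAbove (Set.range T)) (g : ℕ → ℕ)
    (h : ∀ᶠ N : ℕ in atTop, isingTwoPoint (zdGraph 2) (box 2 N) β 0 .free 0 p ≤ T (g N)) :
    twoPointFree 2 β p ≤ ⨆ L, T L :=
  le_of_tendsto (tendsto_isingTwoPoint_free hasBoxLimit_isingCorr_free_holds hβ p)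
    (h.mono fun _ hN => hN.trans (le_ciSup hT _))

end Planar

end StrongSeamOrder

/-! ## Registered sub-goal of stub (S): planar long-range order at `β₂ = decorK 2` -/

open StrongSeamOrder in
/-- **Sub-goal `stub_strongSeamOrder_partD_planarOrder` of stub (S) — planar long-range order at `β₂ = decorK 2`,
uniformly**: there is `m > 0` with `m ≤ ⟨σ₀σ_p⟩^{free}_{β₂}` for every `p ∈ ℤ²` (`m = m*(β₂)²`: `β₂ > β_c(2)` by
`criticalBeta_two_holds` and the numerics, `m*(β₂) > 0`, the free and plus two-point functions agree above `β_c(2)`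
(BGJS), and `m*² ≤ ⟨σ₀σ_p⟩⁺` by GKS). [cite: BenettinGallavottiJonaLasinioStella1973, §3, eq. (3.10)] -/
theorem stub_strongSeamOrder_partD_planarOrder : open Literature.Probability.LatticeModels in (∃ m : ℝ, 0 < m ∧ ∀ p : Site 2, m ≤ twoPointFree 2 (PairIsing.decorK 2) p) := by
  have hβc : criticalBetaTwo < PairIsing.decorK 2 := criticalBetaTwo_lt_decorK_two
  have hβ0 : 0 ≤ PairIsing.decorK 2 := PairIsing.decorK_nonneg 2
  have hc2 : criticalBeta 2 < PairIsing.decorK 2 := by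
    have h : criticalBeta_two := criticalBeta_two_holds
    unfold criticalBeta_two at h
    rw [h]
    exact hβc
  have hm : 0 < spontaneousMagnetization 2 (PairIsing.decorK 2) :=
    spontaneousMagnetization_pos_of_criticalBeta_lt_holds (d := 2) (by norm_num) hc2
  have hm1 : spontaneousMagnetization 2 (PairIsing.decorK 2) ≤ 1 := spontaneousMagnetization_le_one_holds (d := 2) hβ0
  refine ⟨spontaneousMagnetization 2 (PairIsing.decorK 2) ^ 2, pow_pos hm 2, fun p => ?_⟩
  by_cases hp : p = 0
  · subst hp
    rw [twoPointFree_zero]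
    nlinarith
  · rw [twoPointFree_eq_twoPointPlus_of_criticalBetaTwo_lt_holds hβc p]
    exact spontaneousMagnetization_sq_le_twoPointPlus hβ0 hp

end Summit.CriticalPhenomena.Ising3DConformalLimit.Cruxes.TwinThreshold.SeamRenewal

end
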